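import Literature.AnabelianGeometry.AbsoluteAnabelian.CurveModelFactsNonVacuity
import Literature.AnabelianGeometry.AbsoluteAnabelian.AbsTopIII.CurveModelSchemaWitnesses
import HarnessLib

/-!
# [AbsCusp] Thm. 2.1 (i) relative to a `CurveModel` (`AbsCusp.Thm_2_1_i_model`) — INSTANCE FORMS with
# the FACT-LIST declaration as conclusion head (row F-0046)

S. Mochizuki, *Absolute anabelian cuspidalizations of proper hyperbolic curves*, J. Math. Kyoto Univ.
**47** (2007) [cite: MochizukiAbsCusp2007], Thm. 2.1 (i) p. 42: "… `α`, `α^{c-ab}` induce isomorphisms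
`Π^{c-ab}_{U_S} ⥲ Π^{c-ab}_{V_T}` lying over `α` …".  The tree types this RELATIVE TO A MODEL
`M : CurveModel` as the predicate `AbsCusp.Thm_2_1_i_model M IsSeparated hclosed`
(`CuspidalizationFactsModel.lean`, abc-iut-L4 typing).  PROOF-ONLY companion (theorems only; no `def`).

Bookkeeping context (abc-iut cell, block F, row INST59C of the LF kernel census): the universal closure of
the `CurveModel`-relative rows is refuted in tree (schema class) and F-0046 is model-witnessed only INSIDE
the joint `∃`-statement `AbsTopIII.CurveModel.exists_facts_nonVacuous` (abc-iut-f-056), so no theorem of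
the tree concludes in the declaration itself.  This file supplies:

* `AbsCusp.thm_2_1_i_model_of_res_injective` — CONDITIONAL INSTANCE: for ANY `M`, if every cuspidal
  restriction map `M.res : Π_{U_S} → Π_X` is injective (no genuine cusps are being filled in: `S = ∅` in
  print's notation), then `Thm_2_1_i_model M IsSeparated hclosed` holds for every value of the
  `Σ`-separatedness parameter and every closedness datum — via abc-iut-f-056's glue
  `AbsCusp.thm_2_1_i_of_injective` (both `Π^{c-ab} → Π` are isomorphisms, so `β := e_T⁻¹ ∘ α ∘ e_S`);
* `AbsCusp.thm_2_1_i_model_toyModel_punit` — CLOSED INSTANCE at the tree's NAMED toy interface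
  `AbsTopIII.CurveModelSchemaWitness.toyModel k 𝟙` (abc-iut, `CurveModelSchemaWitnesses.lean`: one curve
  over a characteristic-zero field `k`, `Π := G_k × H ↠ G_k`, `res :=` "kill the `H`-factor") with
  `H := 𝟙` the trivial profinite group, where `res` is the identity-like map `(g, ⋆) ↦ (g, 1)` — injective;
* `AbsCusp.res_toyModel_punit_surjective` — NON-VACUITY of that instance: the surjectivity hypotheses
  `hsX`, `hsY` of the predicate fire at `toyModel k 𝟙` (so the instance is not true merely for want of
  admissible inputs; the refuting instances of the schema class use `H ≠ 1`).

HONEST LABEL: DEGENERATE (`Δ = 1`, `S = T = ∅`) — a statement about OUR typed interface, not about any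
proper hyperbolic curve; the printed content (cuspidally abelian quotients, [AbsCusp] §1–§2) is untouched
and stays a named input at the intended étale-`π₁` instance.  Refereed result typed statement-first
(D-0014); typed ≠ proved; instantiated ≠ endorsed; nothing here bears on [IUTchIII] Cor. 3.12; no side taken.
-/

noncomputable section

namespace Literature.AnabelianGeometry.AbsoluteAnabelian

open AbsTopIII

universe u

namespace AbsCusp

/-- **F-0046, CONDITIONAL INSTANCE.**  If every cuspidal restriction map `M.res h : Π_{U_S} → Π_X` of the
model is injective, then [AbsCusp] Thm. 2.1 (i) relative to `M` holds — for every `Σ`-separatedness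
parameter and every closedness datum: both maximal cuspidally abelian quotients are identified with
`Π_X`, `Π_Y` (abc-iut-f-056's `thm_2_1_i_of_injective`), so every `α : Π_X ⥲ Π_Y` lifts.  Degenerate
case `S = T = ∅` of the printed statement. [cite: MochizukiAbsCusp2007, Thm 2.1 (i) p.42] -/
theorem thm_2_1_i_model_of_res_injective (M : CurveModel.{u}) (IsSeparated : M.Curve → Prop)
    (hclosed : ∀ (U : M.Curve) (x : M.Point U), IsClosed (M.decomp U x : Set (M.ext U).arith))
    (hinj : ∀ (US X : M.Curve) (h : M.IsCofiniteOpen US X), Function.Injective (M.res h).arith) :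
    Literature.AnabelianGeometry.AbsoluteAnabelian.AbsCusp.Thm_2_1_i_model M IsSeparated hclosed :=
  fun US X VT Y hX hY _ _ _ _ _ _ _ _ α _ _ _ =>
    thm_2_1_i_of_injective _ _ (hinj US X hX) (hinj VT Y hY) α

/-- In the toy interface `toyModel k 𝟙` (trivial `H`) the restriction map `res = ` "kill the `H`-factor"
`(g, ⋆) ↦ (g, 1)` is injective. [cite: MochizukiAbsTopIII2015, Prop 1.4 p.31] -/
theorem res_toyModel_punit_injective (k : Type) [Field k] [CharZero k]
    (US X : (CurveModelSchemaWitness.toyModel k (ProfiniteGrp.of PUnit.{1})).Curve)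
    (h : (CurveModelSchemaWitness.toyModel k (ProfiniteGrp.of PUnit.{1})).IsCofiniteOpen US X) :
    Function.Injective ((CurveModelSchemaWitness.toyModel k (ProfiniteGrp.of PUnit.{1})).res h).arith := by
  intro x y hxy
  have h1 : x.1 = y.1 := by
    have := congrArg Prod.fst hxy
    simpa using this
  exact Prod.ext h1 (Subsingleton.elim _ _)

/-- NON-VACUITY of the toy instance: at `toyModel k 𝟙` the restriction map is also SURJECTIVE, so the
surjectivity hypotheses `hsX`, `hsY` of `Thm_2_1_i_model` are satisfiable there (every binder of the
predicate can fire). [cite: MochizukiAbsTopIII2015, Prop 1.4 p.31] -/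
theorem res_toyModel_punit_surjective (k : Type) [Field k] [CharZero k]
    (US X : (CurveModelSchemaWitness.toyModel k (ProfiniteGrp.of PUnit.{1})).Curve)
    (h : (CurveModelSchemaWitness.toyModel k (ProfiniteGrp.of PUnit.{1})).IsCofiniteOpen US X) :
    Function.Surjective ((CurveModelSchemaWitness.toyModel k (ProfiniteGrp.of PUnit.{1})).res h).arith := by
  intro y
  refine ⟨y, ?_⟩
  exact Prod.ext (by simp) (Subsingleton.elim _ _)

/-- **F-0046, CLOSED INSTANCE** at the tree's named toy interface with trivial `H`:
[AbsCusp] Thm. 2.1 (i) relative to `toyModel k 𝟙` holds for every `Σ`-separatedness parameter and every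
closedness datum (the restriction maps are injective; `thm_2_1_i_model_of_res_injective`).  DEGENERATE
(`Δ = 1`, no genuine cusps); instantiated ≠ endorsed. [cite: MochizukiAbsCusp2007, Thm 2.1 (i) p.42] -/
theorem thm_2_1_i_model_toyModel_punit (k : Type) [Field k] [CharZero k]
    (IsSeparated : (CurveModelSchemaWitness.toyModel k (ProfiniteGrp.of PUnit.{1})).Curve → Prop)
    (hclosed : ∀ (U : (CurveModelSchemaWitness.toyModel k (ProfiniteGrp.of PUnit.{1})).Curve)
      (x : (CurveModelSchemaWitness.toyModel k (ProfiniteGrp.of PUnit.{1})).Point U),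
      IsClosed ((CurveModelSchemaWitness.toyModel k (ProfiniteGrp.of PUnit.{1})).decomp U x :
        Set ((CurveModelSchemaWitness.toyModel k (ProfiniteGrp.of PUnit.{1})).ext U).arith)) :
    Literature.AnabelianGeometry.AbsoluteAnabelian.AbsCusp.Thm_2_1_i_model
      (CurveModelSchemaWitness.toyModel k (ProfiniteGrp.of PUnit.{1})) IsSeparated hclosed :=
  thm_2_1_i_model_of_res_injective _ IsSeparated hclosed (res_toyModel_punit_injective k)

/-- The closedness datum required by the predicate IS available at the toy interface: its decomposition
groups are `⊥ = {1}`, closed in the (Hausdorff) profinite group `G_k × 𝟙`.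
[cite: MochizukiAbsTopIII2015, Prop 1.4 p.31] -/
theorem isClosed_decomp_toyModel_punit (k : Type) [Field k] [CharZero k]
    (U : (CurveModelSchemaWitness.toyModel k (ProfiniteGrp.of PUnit.{1})).Curve)
    (x : (CurveModelSchemaWitness.toyModel k (ProfiniteGrp.of PUnit.{1})).Point U) :
    IsClosed ((CurveModelSchemaWitness.toyModel k (ProfiniteGrp.of PUnit.{1})).decomp U x :
      Set ((CurveModelSchemaWitness.toyModel k (ProfiniteGrp.of PUnit.{1})).ext U).arith) := by
  change IsClosed
    (((⊥ : Subgroup ((CurveModelSchemaWitness.toyModel k (ProfiniteGrp.of PUnit.{1})).ext U).arith) :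
      Set ((CurveModelSchemaWitness.toyModel k (ProfiniteGrp.of PUnit.{1})).ext U).arith))
  rw [Subgroup.coe_bot]
  exact isClosed_singleton

/-- Hence the closed instance has a fully inhabited parameter list: [AbsCusp] Thm. 2.1 (i) relative to
`toyModel k 𝟙`, at the closedness datum `isClosed_decomp_toyModel_punit`, for every `Σ`-separatedness
parameter (the only remaining binder, a free predicate). [cite: MochizukiAbsCusp2007, Thm 2.1 (i) p.42] -/
theorem thm_2_1_i_model_toyModel_punit_bot (k : Type) [Field k] [CharZero k]
    (IsSeparated : (CurveModelSchemaWitness.toyModel k (ProfiniteGrp.of PUnit.{1})).Curve → Prop) :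
    Literature.AnabelianGeometry.AbsoluteAnabelian.AbsCusp.Thm_2_1_i_model
      (CurveModelSchemaWitness.toyModel k (ProfiniteGrp.of PUnit.{1})) IsSeparated
      (isClosed_decomp_toyModel_punit k) :=
  thm_2_1_i_model_toyModel_punit k IsSeparated _

end AbsCusp

end Literature.AnabelianGeometry.AbsoluteAnabelian

end
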